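import Literature.MathematicalPhysics.QuantumFieldTheory.Balaban1983to89.Node00.LargeFieldTowerShapes
import Literature.MathematicalPhysics.QuantumFieldTheory.Balaban1983to89.Node00.LargeFieldReprOfRecord
import Literature.MathematicalPhysics.QuantumFieldTheory.Balaban1983to89.Node00.ROperationOfRecordAE

/-!
# NODE 00 — DEFINER ₇, FILE 5 (₇b-2): the represented large-field TOWER OF RECORD on dag-n12-b's carrier
# `Node00.LargeFieldTowerShapes` — components, the class decision (i)–(ii) of [IV] p. 177, the `Z′ ∕ Z″` split of (0.3), the
# bond variables, and the ₇b pin `rep := repOfTower (towerOfRecord …)` of FILE 2's residual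

Seat `pub-ymgap-node00-def-R` (DEFINER ₇).  [IV] = [Balaban1989LargeFieldI], [III] = [Balaban1988Convergent], [I] = [Balaban1987RG1].

WHAT THIS FILE IS.  FILE 4 (`Node00.LargeFieldReprOfRecord`) gives the (2.18) [III] representation of record: terms indexed by the
admissible sequences `s = ({Ω_j},{Λ_j})` of record, `χ_k(s)` pinned, the densities `(𝐓_k e^{A_k})(s)` as the residual `texpA`.  dag-n12-b's
`Node00.LargeFieldTowerShapes` fixes the SHAPE of a represented tower ([IV] §1 (1.1)–(1.2) as data: `TowerTerm`, `TowerRep`,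
`TowerOfRecord`) and the pin shape `repOfTower`.  This file DEFINES the tower of record on that shape:
* §A  torus-touching COMPONENTS of a family of cube indices (`TorusTouching` = sup-distance `≤ 1` modulo the number `q` of cubes per
  direction — `B14Components.Touching` read on the torus, seam included; `ttComp`, `ttComps`, finiteness, cover) and CONDITION (i) of
  p. 177 on the torus (`FitsInTorus q Nsz C`: *«contained in a cube of the size 100 M R_k»*, a box of `Nsz` consecutive residues per
  direction; `B16StoppingRule.CondI` ∕ `B14BoxFix.FitsIn` is the `ℤᵈ` index model);
* §B  the cube-index family `idxIn P s Z` of a torus region, its `carrier`, the components `compIdx` of a region read on its `s`-cubes,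
  the iterated block map `blockIter : T^{(0)} → T^{(n)}` and the bonds of `T^{(n)}` MEETING a region (`bondsMeeting`);
* §C  the integer numerics `TowerNumerics` (`M` = [I]'s cube size, `Nsz` = print's `100`, `Nmem` = the `N` of (ii)), the `𝐃_l`-cube side
  `dSide`, CLEANLINESS `CleanAt s X l` (*«no new large field regions were created inside this component»* at step `l`, MODELLED on the
  sequence as `Z_l ∩ X = Z_{l−1} ∩ X` — `B16StoppingRule.CondII` keeps it a parameter; a located reading), THE CLASS DECISION
  `AdmissibleComp` = (i) ∧ (ii) (inclusive reading of `CondII`), `Z′` of a sequence `zpOfSeq` (union of the carriers of the passing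
  components; `zpOfSeq_subset : Z′ ⊆ Z`), **`termOfSeq`** (dag-n12-b's `TowerTerm`: `Zset := cover ⁻¹' Λ_kᶜ` — the tree's periodic-lift
  convention `B15Eq112TorusCover.pullSeq` —, `Comp` ∕ `compSet` the components with their lifted carriers, `Zp` ∕ `Zpp := Z ∖ Z′`,
  `compVars` ∕ `fibVars := fibOfSeq` the `T^{(k)}`-bonds meeting `X_i` ∕ `Z′`, `piece := χ_k(s)·(𝐓_k e^{A_k})(s)`; `termOfSeq_Zp_union_Zpp`,
  `termOfSeq_disjoint`), the residual SELECTOR `PpSelOfRecord` of the denominator term *«ρ(Z″, ·)»* of (0.3), **`towerRepOfRecord`**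
  (`ι :=` sequences of record, `pp :=` the selector) with `towerRepOfRecord_total : total = densityOfRepr` (`rfl`), **`towerOfRecord :
  TowerOfRecord F N`** (step `k + 1` along the record's couplings `gsel p`), the pin **`repOfRecord := repOfTower F N (towerOfRecord …)`**
  and `ROp03OfRecord_repOfRecord_of_provisos` (on the record's own represented density, under the provisos of p. 176, FILE 2's `R` of
  record IS print's (0.3) of this tower — dag-n12-b's lemma, by name).
* §D  the (R3) twin (chair ★★ R437 (2), FILE 6 `Node00.ROperationOfRecordAE`): **`repOfRecordAE := repOfDataAE F N (fun p k => (towerOfRecord …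
  p k).toRepData)`** and `ROp03AEOfRecord_repOfRecordAE_of_ae` — on every density A.E.-equal to the record's represented one, under the provisos,
  `R` of record (v1.1) is the explicit (0.3) of the tower.

HONEST SCOPE.  Definitions of record + set-level kernel bookkeeping.  LOCATED READINGS, flagged for dag-n12-a ∕ dag-n12-b: «components»
:= touching components of closed `M R_k`-cubes (corner contact connects; [I] p. 257's class `𝐃_j` is WALL-connected — a different,
finer notion, `B14Components.WallAdjacent`); (ii)'s cleanliness := `CleanAt`; «V restricted to a neighbourhood of X_i» ∕ `V_{Z′}` := the
bonds with an endpoint whose `k`-block contains a point of the region (`bondsMeeting`).  THE SELECTOR `pp` IS RESIDUAL DATA: at the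
schematic level of (0.3) there is no canonical «term ρ(Z″, ·)» on sequences (deleting the `Z′`-components from `Λ_kᶜ` need not leave an
admissible sequence; print p. 177 *«The actual procedure is more complicated»*) — the faithful object is the (1.100) datum
(`Node00.ROperationOfRecord1100`), whose pin from FILE 4's data is the next file.  Nothing of Bałaban's asserted: no (1.1) factorisation,
no (1.2), no positivity, no non-emptiness of integration domains, no estimate; that the record's density IS `densityOfRepr` is Theorem 1
[III] ∕ `Residual₅.S218` (DEFINER ₆, N-cells).  Counts unmoved (typed 28∕28 · discharged 1∕28); nothing continuum ∕ ℝ⁴ ∕ OS ∕ mass-gap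
∕ Clay.  No `sorry` ∕ `axiom` ∕ `opaque` ∕ `instance` ∕ `notation`.
-/

namespace Literature.MathematicalPhysics.QuantumFieldTheory.Balaban1983to89.Node00

open MeasureTheory
open scoped BigOperators
open T4Continuum B15DeterminingSets B14.Eq213DetSet B14.Eq216Concrete B14.Eq213MaximalDomains B15Eq112TorusCover
  B14DomainGeom B14.Eq218Concrete B15RopTotal

noncomputable section

/-! ## §A  Torus-touching components of a family of cube indices -/

section TorusComponents

variable {d : ℕ}

/-- Two cube indices TOUCH ON THE TORUS with `q` cubes per direction: in every direction their indices agree or differ by `±1`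
modulo `q` (sup-distance `≤ 1` on `(ℤ∕q)ᵈ`; `B14Components.Touching` is the same relation on `ℤᵈ`, without the seam).
[cite: Balaban1989LargeFieldI, p.177 («Z = X_1 ∪ … ∪ X_n … components»); Balaban1987RG1, p.257] -/
def TorusTouching (q : ℕ) (a b : Pt d) : Prop :=
  ∀ i, (a i - b i) % (q : ℤ) = 0 ∨ (a i - b i) % (q : ℤ) = 1 ∨ (b i - a i) % (q : ℤ) = 1

/-- Connectedness inside `R` by chains of torus-touching indices of `R`. [cite: Balaban1989LargeFieldI, p.177 (components)] -/
def TTConn (q : ℕ) (R : Set (Pt d)) : Pt d → Pt d → Prop :=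
  Relation.ReflTransGen fun x y => x ∈ R ∧ y ∈ R ∧ TorusTouching q x y

/-- The torus-touching component of `a` in `R`. [cite: Balaban1989LargeFieldI, p.177 (components)] -/
def ttComp (q : ℕ) (R : Set (Pt d)) (a : Pt d) : Set (Pt d) := {b | TTConn q R a b}

/-- `a` lies in its own component. [cite: Balaban1989LargeFieldI, p.177 (bookkeeping)] -/
theorem mem_ttComp_self (q : ℕ) (R : Set (Pt d)) (a : Pt d) : a ∈ ttComp q R a := Relation.ReflTransGen.refl

/-- A component of a point of `R` lies in `R`. [cite: Balaban1989LargeFieldI, p.177 (bookkeeping)] -/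
theorem ttComp_subset {q : ℕ} {R : Set (Pt d)} {a : Pt d} (ha : a ∈ R) : ttComp q R a ⊆ R := by
  intro b hb
  induction hb with
  | refl => exact ha
  | tail _ h _ => exact h.2.1

/-- The set of components of `R`. [cite: Balaban1989LargeFieldI, p.177 (components)] -/
def ttComps (q : ℕ) (R : Set (Pt d)) : Set (Set (Pt d)) := ttComp q R '' R

/-- Finitely many components of a finite index family. [cite: Balaban1989LargeFieldI, p.177 (bookkeeping)] -/
theorem ttComps_finite (q : ℕ) {R : Set (Pt d)} (hR : R.Finite) : (ttComps q R).Finite := hR.image _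

/-- The components cover `R`. [cite: Balaban1989LargeFieldI, p.177 (bookkeeping)] -/
theorem sUnion_ttComps (q : ℕ) (R : Set (Pt d)) : ⋃₀ ttComps q R = R := by
  apply Set.Subset.antisymm
  · rintro b ⟨C, ⟨a, ha, rfl⟩, hb⟩; exact ttComp_subset ha hb
  · intro a ha; exact ⟨ttComp q R a, ⟨a, ha, rfl⟩, mem_ttComp_self q R a⟩

/-- CONDITION (i) of [IV] p. 177 ON THE TORUS: the family of cube indices `C` *«is contained in a cube of the size»* `Nsz` cubes per
side, read modulo `q` (a box of `Nsz` consecutive residues in every direction; `B16StoppingRule.CondI` ∕ `B14BoxFix.FitsIn` is the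
same condition in the `ℤᵈ` index model). [cite: Balaban1989LargeFieldI, p.177 (condition (i))] -/
def FitsInTorus (q Nsz : ℕ) (C : Set (Pt d)) : Prop :=
  ∃ c : Pt d, ∀ a ∈ C, ∀ i, ∃ t : ℤ, 0 ≤ t ∧ t < Nsz ∧ (a i - c i - t) % (q : ℤ) = 0

end TorusComponents

/-! ## §B  Cube-index families of torus regions, their carriers, iterated blocks -/

section RegionGeometry

variable (P : Params)

/-- Number of `s`-cubes per direction of the torus cube family `cubeIndices P s`. [cite: Balaban1988Convergent, (2.17) p.257 (bookkeeping)] -/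
def cubesPerDir (s : ℕ) : ℕ := (P.sitesPerDir 0 + s - 1) / s

/-- The indices of the `s`-cubes lying inside a torus region `Z`. [cite: Balaban1989LargeFieldI, p.177 (bookkeeping)] -/
def idxIn (s : ℕ) (Z : Set (Site P 0)) : Set (Pt P.d) := {a | a ∈ cubeIndices P s ∧ cubeEnl P s a 0 ⊆ Z}

/-- Finitely many cubes lie in a region. [cite: Balaban1989LargeFieldI, p.177 (bookkeeping)] -/
theorem idxIn_finite (s : ℕ) (Z : Set (Site P 0)) : (idxIn P s Z).Finite :=
  (cubeIndices P s).finite_toSet.subset fun _ h => h.1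

/-- The torus point set carried by a family of `s`-cube indices. [cite: Balaban1989LargeFieldI, p.177 (bookkeeping)] -/
def carrier (s : ℕ) (C : Set (Pt P.d)) : Set (Site P 0) := ⋃ a ∈ C, cubeEnl P s a 0

/-- The components of a torus region `Z` read on its `s`-cubes: torus-touching components of `idxIn P s Z`.
[cite: Balaban1989LargeFieldI, (1.1) p.177 («Z = X_1 ∪ … ∪ X_n»)] -/
def compIdx (s : ℕ) (Z : Set (Site P 0)) : Set (Set (Pt P.d)) := ttComps (cubesPerDir P s) (idxIn P s Z)

/-- Finitely many components. [cite: Balaban1989LargeFieldI, (1.1) p.177 (bookkeeping)] -/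
theorem compIdx_finite (s : ℕ) (Z : Set (Site P 0)) : (compIdx P s Z).Finite := ttComps_finite _ (idxIn_finite P s Z)

variable {P}

/-- The iterated block map `T^{(0)} → T^{(n)}` (`Setup.blockOf` `n` times). [cite: Balaban1987RG1, (0.1) p.252] -/
def blockIter : (n : ℕ) → Site P 0 → Site P n
  | 0 => id
  | n + 1 => fun x => blockOf (blockIter n x)

/-- The positively oriented bonds of `T^{(n)}` MEETING a torus region `S ⊂ T_η`: an endpoint is the `n`-block of a point of `S` — the
bond variables *«on (a neighbourhood of)»* the region ((1.1): «V_k restricted to a neighbourhood of X_i»; (0.3): `V_{Z′}`).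
[cite: Balaban1989LargeFieldI, (1.1) p.177, (0.3) p.176] -/
def bondsMeeting (n : ℕ) (S : Set (Site P 0)) : Set (PBond P n) :=
  {b | ∃ x ∈ S, blockIter n x = b.src ∨ blockIter n x = b.tgt}

end RegionGeometry

/-! ## §C  The numerics of (i)–(ii), the class decision, the term of an admissible sequence, the tower OF RECORD -/

section Tower

variable (F : T4Family) (N : ℕ) [NeZero N]

/-- The integer numerics of the large-field tower of record beyond `Stage7Numerics`: `M` = [I]'s basic cube size (the `𝐃_j` cubes are
`M R_j`-cubes), `Nsz` = the size threshold of condition (i) (*«a cube of the size 100 M R_k»*: print `100`), `Nmem` = the memory `N`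
of condition (ii) (*«in the preceding N renormalization steps»*). [cite: Balaban1989LargeFieldI, p.177 (conditions (i), (ii)); Balaban1988Convergent, (2.1) p.254] -/
structure TowerNumerics where
  /-- [I]'s basic cube size `M` (the `𝐃_j` cubes are `M R_j`-cubes) -/
  M : ℕ
  /-- the size threshold of condition (i), print's `100` (in `M R_k`-cubes per side) -/
  Nsz : ℕ
  /-- the memory `N` of condition (ii) -/
  Nmem : ℕ

/-- The `𝐃_l`-cube side (fine sites) at scale `l` along the couplings `g`: `L^l · M · R_l`, `R_l = RkOfRecord L r g_l`.
[cite: Balaban1988Convergent, (2.1) p.254, (2.5) p.255] -/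
def dSide (ν : Stage7Numerics) (M : ℕ) (g : ℕ → ℝ) (K l : ℕ) : ℕ :=
  dCubeSide (F.P K).L M (RkOfRecord (F.P K).L ν.r (g l)) l

variable {F} in
/-- CLEANLINESS of a torus point set `X` at scale `l` along an admissible sequence — the located reading of (ii)'s *«no new large field
regions were created inside this component»* at step `l`: the large-field region `Z_l = Λ_lᶜ` ((2.3)) meets `X` exactly as `Z_{l−1}`
does (`B16StoppingRule.CondII` keeps this clause a parameter `Clean`; here it is MODELLED on the sequence — a located reading,
dag-n12-a's to confirm). [cite: Balaban1989LargeFieldI, p.177 (condition (ii)); Balaban1988Convergent, (2.3) p.255] -/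
def CleanAt {ν : Stage7Numerics} {M : ℕ} {g : ℕ → ℝ} {K k : ℕ} (s : SeqOfRecord F ν M g K k) (X : Set (Site (F.P K) 0))
    (l : ℕ) : Prop :=
  (s.Λ l)ᶜ ∩ X = (s.Λ (l - 1))ᶜ ∩ X

/-- THE CLASS DECISION of [IV] p. 177 for a component `C` (a family of `𝐃_k`-cube indices) of the last large-field region of an
admissible sequence at step `k`: (i) `C` fits in a cube of `Nsz` cubes per side (on the torus), AND (ii) (inclusive reading, as
`B16StoppingRule.CondII`): `Nmem ≤ k` and at each of the scales `l = k − Nmem + 1, …, k` the component is clean and the previous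
region inside it, `Z_l ∩ X`, read on the `𝐃_l`-cubes, satisfies (i) (LOCATED READING: for `k < Nmem` the clause `Nmem ≤ k` makes the
class empty — conservative; print does not discuss the first `N` steps, where no large-field region is `N` steps old).  Components passing it form `Z′` (*«components for which the
corresponding expressions require a renormalization»*, p. 176), the rest `Z″`. [cite: Balaban1989LargeFieldI, p.177 (conditions (i), (ii)), p.176 (Z′, Z″)] -/
def AdmissibleComp (ν : Stage7Numerics) (τ : TowerNumerics) (g : ℕ → ℝ) (K k : ℕ) (s : SeqOfRecord F ν τ.M g K k)
    (C : Set (Pt (F.P K).d)) : Prop :=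
  FitsInTorus (cubesPerDir (F.P K) (dSide F ν τ.M g K k)) τ.Nsz C ∧
  τ.Nmem ≤ k ∧ ∀ l, k < l + τ.Nmem → l ≤ k →
    CleanAt s (carrier (F.P K) (dSide F ν τ.M g K k) C) l ∧
    FitsInTorus (cubesPerDir (F.P K) (dSide F ν τ.M g K l)) τ.Nsz
      (idxIn (F.P K) (dSide F ν τ.M g K l) ((s.Λ l)ᶜ ∩ carrier (F.P K) (dSide F ν τ.M g K k) C))

open Classical in
/-- The union of the carriers of the components of `Z_k = Λ_kᶜ` PASSING THE CLASS DECISION (i)∧(ii), as a torus point set — print p. 177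
*«Let us denote the union of the above class of components by Z»*.  LOCATED REMARK (dag-n12-b [7B-REVIEW-1]): this is the `Z′` slot of the
SCHEMATIC (0.3) only; in the actual procedure (1.99)–(1.100) the integrated set `Z′` is a neighbourhood of `∂Z` inside these components, not all
of them — the faithful object is the (1.100) datum (`Node00.ROperationOfRecord1100`); a referee should not read `zpOfSeq = Z′` of §1 [IV].
[cite: Balaban1989LargeFieldI, (0.3) p.176, p.177, (1.99)–(1.100) p.201] -/
def zpOfSeq (ν : Stage7Numerics) (τ : TowerNumerics) (g : ℕ → ℝ) (K k : ℕ) (s : SeqOfRecord F ν τ.M g K k) :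
    Set (Site (F.P K) 0) :=
  {x | ∃ C ∈ compIdx (F.P K) (dSide F ν τ.M g K k) (s.Λ k)ᶜ,
    AdmissibleComp F ν τ g K k s C ∧ x ∈ carrier (F.P K) (dSide F ν τ.M g K k) C}

/-- `Z′ ⊆ Z`: the carriers of components of cubes inside `Z_k` lie in `Z_k`. [cite: Balaban1989LargeFieldI, (0.3) p.176 (bookkeeping)] -/
theorem zpOfSeq_subset (ν : Stage7Numerics) (τ : TowerNumerics) (g : ℕ → ℝ) (K k : ℕ) (s : SeqOfRecord F ν τ.M g K k) :
    zpOfSeq F ν τ g K k s ⊆ (s.Λ k)ᶜ := by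
  rintro x ⟨C, ⟨a, ha, rfl⟩, -, hx⟩
  simp only [carrier, Set.mem_iUnion] at hx
  obtain ⟨b, hb, hxb⟩ := hx
  exact (ttComp_subset ha hb).2 hxb

open Classical in
/-- **The fibre bond set of a sequence**: the `T^{(k)}`-bond variables over which (0.3) integrates for the sequence `s` — the bonds meeting
`Z′(s)` (pure geometry of the sequence, independent of the `(𝐓_k e^{A_k})` slot; it IS the term's `fibVars`, `termOfSeq_fibVars`).
[cite: Balaban1989LargeFieldI, (0.3) p.176, (1.1) p.177] -/
def fibOfSeq (ν : Stage7Numerics) (τ : TowerNumerics) (p : B12.RunParams) (g : ℕ → ℝ) (k : ℕ)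
    (s : SeqOfRecord F ν τ.M g p.K k) : Finset (PBond (F.P p.K) k) :=
  Finset.univ.filter fun b => b ∈ bondsMeeting k (zpOfSeq F ν τ g p.K k s)

open Classical in
/-- **THE TERM of an admissible sequence** at run `p`, couplings `g`, step `k`, on dag-n12-b's two-layer shape: geometry — `Z = Λ_kᶜ`
(periodic lift `cover ⁻¹'`, the tree's convention `B15Eq112TorusCover.pullSeq`), its torus-touching components on the `𝐃_k`-cubes with
their carriers, `Z′` ∕ `Z″ = Z ∖ Z′` by the class decision; integration data — the `T^{(k)}`-bond variables meeting each component and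
meeting `Z′`, and the piece `χ_k(s)·(𝐓_k e^{A_k})(s)` of (2.18). [cite: Balaban1989LargeFieldI, (1.1) p.177, (0.2)–(0.3) p.176; Balaban1988Convergent, (2.18) p.257] -/
def termOfSeq (ν : Stage7Numerics) (τ : TowerNumerics) (texpA : TexpAOfRecord F N ν τ.M) (p : B12.RunParams) (g : ℕ → ℝ)
    (k : ℕ) (s : SeqOfRecord F ν τ.M g p.K k) : TowerTerm (F.P p.K) k (SU N) where
  Zset := cover (F.P p.K) ⁻¹' (s.Λ k)ᶜ
  Comp := ↥(compIdx (F.P p.K) (dSide F ν τ.M g p.K k) (s.Λ k)ᶜ)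
  finComp := @Fintype.ofFinite _ (compIdx_finite (F.P p.K) (dSide F ν τ.M g p.K k) (s.Λ k)ᶜ).to_subtype
  compSet C := cover (F.P p.K) ⁻¹' carrier (F.P p.K) (dSide F ν τ.M g p.K k) C.1
  Zp := cover (F.P p.K) ⁻¹' zpOfSeq F ν τ g p.K k s
  Zpp := cover (F.P p.K) ⁻¹' ((s.Λ k)ᶜ \ zpOfSeq F ν τ g p.K k s)
  compVars C := bondsMeeting k (carrier (F.P p.K) (dSide F ν τ.M g p.K k) C.1)
  fibVars := fibOfSeq F ν τ p g k s
  piece V := chiSeqOfRecord F N ν τ.M g p.K k s V * texpA p g k s V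

/-- The term's region IS the pulled-back last large-field region of the (2.18) datum of record. [cite: Balaban1989LargeFieldI, (0.2) p.176 (bookkeeping)] -/
theorem termOfSeq_Zset (ν : Stage7Numerics) (τ : TowerNumerics) (texpA : TexpAOfRecord F N ν τ.M) (p : B12.RunParams)
    (g : ℕ → ℝ) (k : ℕ) (s : SeqOfRecord F ν τ.M g p.K k) :
    (termOfSeq F N ν τ texpA p g k s).Zset = cover (F.P p.K) ⁻¹' (repr218OfRecord F N ν τ.M texpA p g k).lastZ s := rfl

/-- The term's fibre variables ARE `fibOfSeq` (`rfl`). [cite: Balaban1989LargeFieldI, (0.3) p.176 (bookkeeping)] -/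
theorem termOfSeq_fibVars (ν : Stage7Numerics) (τ : TowerNumerics) (texpA : TexpAOfRecord F N ν τ.M) (p : B12.RunParams)
    (g : ℕ → ℝ) (k : ℕ) (s : SeqOfRecord F ν τ.M g p.K k) :
    (termOfSeq F N ν τ texpA p g k s).fibVars = fibOfSeq F ν τ p g k s := rfl

/-- `Z = Z′ ∪ Z″` for the term (disjointly: `Z″ = Z ∖ Z′`, `Z′ ⊆ Z`). [cite: Balaban1989LargeFieldI, p.176 («Z = Z′ ∪ Z″»)] -/
theorem termOfSeq_Zp_union_Zpp (ν : Stage7Numerics) (τ : TowerNumerics) (texpA : TexpAOfRecord F N ν τ.M) (p : B12.RunParams)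
    (g : ℕ → ℝ) (k : ℕ) (s : SeqOfRecord F ν τ.M g p.K k) :
    (termOfSeq F N ν τ texpA p g k s).Zp ∪ (termOfSeq F N ν τ texpA p g k s).Zpp = (termOfSeq F N ν τ texpA p g k s).Zset := by
  show cover (F.P p.K) ⁻¹' _ ∪ cover (F.P p.K) ⁻¹' _ = cover (F.P p.K) ⁻¹' _
  rw [← Set.preimage_union, Set.union_sdiff_cancel (zpOfSeq_subset F ν τ g p.K k s)]

/-- `Z′` and `Z″` of the term are disjoint. [cite: Balaban1989LargeFieldI, p.176 («disjoint subregions Z′, Z″»)] -/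
theorem termOfSeq_disjoint (ν : Stage7Numerics) (τ : TowerNumerics) (texpA : TexpAOfRecord F N ν τ.M) (p : B12.RunParams)
    (g : ℕ → ℝ) (k : ℕ) (s : SeqOfRecord F ν τ.M g p.K k) :
    Disjoint (termOfSeq F N ν τ texpA p g k s).Zp (termOfSeq F N ν τ texpA p g k s).Zpp := by
  show Disjoint (cover (F.P p.K) ⁻¹' _) (cover (F.P p.K) ⁻¹' _)
  exact (Set.disjoint_sdiff_right).preimage _

/-- RESIDUAL DATA: the selector of *«the term ρ(Z″, ·)»* of (0.3) — for each admissible sequence the sequence indexing the denominator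
term.  INTENDED MEANING: the term with the large-field data unchanged off `Z′` and `Z′` declared small.  NO CANONICAL CHOICE on sequences
(dag-n12-b's answer A7, [7B-REVIEW-1]: deleting the `Z′`-components from `Λ_kᶜ` is not admissibility-preserving, and regrouping by the last
region forgets the history (ii) reads; print p. 177 *«The actual procedure is more complicated»*) — the faithful object is the (1.100) datum
of §1 [IV] (`Node00.ROperationOfRecord1100`, v2 LANDED p412348). [cite: Balaban1989LargeFieldI, (0.3) p.176, p.177] -/
abbrev PpSelOfRecord (ν : Stage7Numerics) (M : ℕ) : Type :=
  (p : B12.RunParams) → (g : ℕ → ℝ) → (k : ℕ) → SeqOfRecord F ν M g p.K k → SeqOfRecord F ν M g p.K k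

/-- The represented tower at run `p`, couplings `g`, step `k`: terms = admissible sequences of record, `Z ↦ Z″` = the residual selector.
[cite: Balaban1989LargeFieldI, (0.2)–(0.3) p.176; Balaban1988Convergent, (2.18) p.257] -/
def towerRepOfRecord (ν : Stage7Numerics) (τ : TowerNumerics) (texpA : TexpAOfRecord F N ν τ.M) (ppSel : PpSelOfRecord F ν τ.M)
    (p : B12.RunParams) (g : ℕ → ℝ) (k : ℕ) : TowerRep (F.P p.K) k (SU N) where
  ι := SeqOfRecord F ν τ.M g p.K k
  pp := ppSel p g k
  term := termOfSeq F N ν τ texpA p g k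

/-- The tower's total density IS the density assembled from the (2.18) datum of record ((0.2) = (2.18) regrouped).
[cite: Balaban1989LargeFieldI, (0.2) p.176 (bookkeeping)] -/
theorem towerRepOfRecord_total (ν : Stage7Numerics) (τ : TowerNumerics) (texpA : TexpAOfRecord F N ν τ.M)
    (ppSel : PpSelOfRecord F ν τ.M) (p : B12.RunParams) (g : ℕ → ℝ) (k : ℕ) :
    (towerRepOfRecord F N ν τ texpA ppSel p g k).total = densityOfRepr F N ν τ.M texpA p g k := rfl

/-- **THE TOWER OF RECORD** (dag-n12-b's `TowerOfRecord`): at run `p` and step `k` the represented tower after `k + 1` steps along the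
record's couplings `gsel p` (at the record: `genSeq θ.res.βfun p.g0`). [cite: Balaban1989LargeFieldI, (0.2) p.176, (1.1) p.177] -/
def towerOfRecord (ν : Stage7Numerics) (τ : TowerNumerics) (texpA : TexpAOfRecord F N ν τ.M) (ppSel : PpSelOfRecord F ν τ.M)
    (gsel : B12.RunParams → ℕ → ℝ) : TowerOfRecord F N :=
  fun p k => towerRepOfRecord F N ν τ texpA ppSel p (gsel p) (k + 1)

/-- **THE ₇b PIN of DEFINER ₇'s residual `rep`**: `repOfTower` of the tower of record — Bałaban's (0.2)-data exactly on the record's own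
represented density, the one-region convention elsewhere; the residual is now (`texpA`, `ppSel`). [cite: Balaban1989LargeFieldI, (0.2)–(0.3) p.176] -/
def repOfRecord (ν : Stage7Numerics) (τ : TowerNumerics) (texpA : TexpAOfRecord F N ν τ.M) (ppSel : PpSelOfRecord F ν τ.M)
    (gsel : B12.RunParams → ℕ → ℝ) : RepOfRecord F N :=
  repOfTower F N (towerOfRecord F N ν τ texpA ppSel gsel)

open Classical in
/-- On the record's own represented density after `k + 1` steps, `R` of record (FILE 2, v1) is `ropTotal` of the tower's `RepData` —
and print's (0.3) under the provisos (dag-n12-b's `ROp03OfRecord_repOfTower_total_of_provisos`). [cite: Balaban1989LargeFieldI, (0.3) p.176 (bookkeeping)] -/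
theorem ROp03OfRecord_repOfRecord_of_provisos (ν : Stage7Numerics) (τ : TowerNumerics) (texpA : TexpAOfRecord F N ν τ.M)
    (ppSel : PpSelOfRecord F ν τ.M) (gsel : B12.RunParams → ℕ → ℝ) (p : B12.RunParams) (k : ℕ)
    (h : (towerOfRecord F N ν τ texpA ppSel gsel p k).toRepData.Provisos) :
    ROp03OfRecord F N (repOfRecord F N ν τ texpA ppSel gsel) p k (densityOfRepr F N ν τ.M texpA p (gsel p) (k + 1)) =
      (towerOfRecord F N ν τ texpA ppSel gsel p k).toRepData.rop :=
  ROp03OfRecord_repOfTower_total_of_provisos F N _ p k h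

end Tower

/-! ## §D  The (R3) twin of the pin (chair R437 (2); FILE 6 `Node00.ROperationOfRecordAE`) -/

section TowerAE

variable (F : T4Family) (N : ℕ) [NeZero N]

open Classical in
/-- **THE (R3) PIN of FILE 2's residual by the tower of record**: Bałaban's data on every density A.E.-EQUAL to the record's represented density
(FILE 6 `repOfDataAE` at the `RepData` of the tower), the one-region convention elsewhere — the pin node00-def's `Record7` successor uses with
`R := ROp03AEOfRecord`. [cite: Balaban1989LargeFieldI, (0.2)–(0.3) p.176] -/
def repOfRecordAE (ν : Stage7Numerics) (τ : TowerNumerics) (texpA : TexpAOfRecord F N ν τ.M) (ppSel : PpSelOfRecord F ν τ.M)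
    (gsel : B12.RunParams → ℕ → ℝ) : RepOfRecord F N :=
  repOfDataAE F N fun p k => (towerOfRecord F N ν τ texpA ppSel gsel p k).toRepData

open Classical in
/-- **On a density a.e.-equal to the record's represented density, under the provisos of p. 176, `R` of record (v1.1) IS the explicit (0.3) of
the tower of record** (FILE 6 `ROp03AEOfRecord_repOfDataAE_of_ae`, by name). [cite: Balaban1989LargeFieldI, (0.3)–(0.4) p.176] -/
theorem ROp03AEOfRecord_repOfRecordAE_of_ae (ν : Stage7Numerics) (τ : TowerNumerics) (texpA : TexpAOfRecord F N ν τ.M)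
    (ppSel : PpSelOfRecord F ν τ.M) (gsel : B12.RunParams → ℕ → ℝ) (p : B12.RunParams) (k : ℕ)
    {ρ : Density (F.P p.K) (k + 1) (SU N)}
    (hae : (towerOfRecord F N ν τ texpA ppSel gsel p k).toRepData.total =ᵐ[fieldMeasure (F.P p.K) (k + 1) (SU N)] ρ)
    (hprov : (towerOfRecord F N ν τ texpA ppSel gsel p k).toRepData.Provisos) :
    ROp03AEOfRecord F N (repOfRecordAE F N ν τ texpA ppSel gsel) p k ρ
      = (towerOfRecord F N ν τ texpA ppSel gsel p k).toRepData.rop :=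
  ROp03AEOfRecord_repOfDataAE_of_ae F N _ hae hprov

end TowerAE

end

end Literature.MathematicalPhysics.QuantumFieldTheory.Balaban1983to89.Node00
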